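import Literature.Topology.FourManifolds.TrisectionsAssembly
import HarnessLib

/-!
# The third handlebody `H₂₃ = X₂ ∩ X₃` of the trisection from a handle decomposition: the set
# (Gay–Kirby 2016, Lemma 14 — towards clause (iii) for the pair `(X₂, X₃)`)

Topic `Literature/Topology/FourManifolds`; for the fact seat
`provefact-Literature.Topology.FourManifolds.exists_isBalancedGKTrisection` (Gay–Kirby 2016,
Thm. 4 via Lemma 14).  Everything in this file is **proved**; no named facts are introduced.

Gay–Kirby, proof of Lemma 14: *"`X₂ ∩ ([1 + ε] × ∂X₁ ∪ 2-handles) = H₂₃` which equals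
`F × [-ε, ε] ∪ 2-handles`, which is a handlebody"*.  In the flow-line construction of
`TrisectionsMiddleSectors.lean` (sectors divided by the rounded function `M`) the intersection
`H₂₃ = X₂ ∩ X₃` (`TriData.H₂₃`) decomposes as

`H₂₃ = F ∪ {x ∉ X₁ | x hits ∂X₁⁰, M x = 0} ∪ {x ∉ X₁ | x does not hit, f x = c}`

(`mem_H₂₃_iff`: the central surface, the rounded interface between `X₂` and `X₃` — the sheet
`{G = 0}` over `F` bent into the top lid `{f = c}` over `{G ≤ -ε}` — and the tops of the
ascending sheets of the index-`2` critical points), it meets `X₁` exactly in `F`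
(`H₂₃_inter_X₁`), and near `F`, in the bi-collar box, it is the half-sheet `{r = 0, s ≥ 0}`
over `F` (`mem_H₂₃_iff_of_mem_box`) — the common face of the wedges
`X₂ = {r ≤ 0, s - κ r ≥ 0}` and `X₃ = {r ≥ 0, s + κ r ≥ 0}`, with boundary `F = {r = s = 0}`.
These are the set-theoretic inputs of the manifold-with-boundary structure of `H₂₃` (charts:
the straightening charts of `TrisectionsMiddleCharts.lean` off `F`, the wedge charts at `F`).

## References

* D. Gay, R. Kirby, *Trisecting 4-manifolds*, Geom. Topol. 20 (2016) 3097–3132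
  (arXiv:1205.1565): Def. 1; §4, Lemma 14 and its proof. [GayKirby2016]
-/

open scoped Manifold ContDiff Topology
open Set Function Filter

noncomputable section

universe u

namespace Literature.Topology.FourManifolds

variable {X : Type u} [TopologicalSpace X] [T2Space X] [CompactSpace X]
  [ChartedSpace (EuclideanSpace ℝ (Fin 4)) X] [IsManifold (𝓡 4) ∞ X]

namespace BiCollar

namespace TriData

variable {B : BiCollar X} (T : B.TriData)

/-- **The third handlebody** `H₂₃ = X₂ ∩ X₃`. [cite: GayKirby2016, §4, Lemma 14] -/
def H₂₃ : Set X := T.X₂ ∩ T.X₃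

/-- `H₂₃` is closed. [folklore] -/
theorem isClosed_H₂₃ : IsClosed T.H₂₃ := T.isClosed_X₂.inter T.isClosed_X₃

/-- `H₂₃` is compact. [folklore] -/
theorem isCompact_H₂₃ : IsCompact T.H₂₃ := T.isClosed_H₂₃.isCompact

/-- The central surface lies in `H₂₃`. [cite: GayKirby2016, Def. 1] -/
theorem surface_subset_H₂₃ : B.surface ⊆ T.H₂₃ := fun _ hx => ⟨T.surface_subset_X₂ hx, T.surface_subset_X₃ hx⟩

/-- `H₂₃ ⊆ {f ≤ c}` (as `X₂` does). [folklore] -/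
theorem f_le_c_of_mem_H₂₃ {x : X} (hx : x ∈ T.H₂₃) : B.f x ≤ T.c := T.f_le_c_of_mem_X₂ hx.1

section

variable (hc2 : B.a + B.U.δ + 2 * T.ε ≤ T.c) {η : ℝ} (hη : 2 * T.ε ≤ η)
  (hL : ∀ q : X, IsMCriticalPt (𝓡 4) B.f q → B.a < B.f q → B.f q ≤ T.c →
    ∀ y : B.Y, RegularLevel.incl B.hf y ∈ stableSet (𝓡 4) B.U.ξ q → B.g y < B.b - η)

include hc2 in
/-- **`H₂₃` meets `X₁` exactly in the central surface.** [cite: GayKirby2016, Def. 1] -/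
theorem H₂₃_inter_X₁ : T.H₂₃ ∩ T.X₁ = B.surface := by
  rw [← T.iInter_eq_surface hc2]
  ext x
  simp only [mem_inter_iff, mem_iInter]
  constructor
  · rintro ⟨⟨h2, h3⟩, h1⟩ i
    fin_cases i
    · exact h1
    · exact h2
    · exact h3
  · intro h
    exact ⟨⟨h 1, h 2⟩, h 0⟩

include hc2 hη hL in
/-- **The decomposition of `H₂₃`**: the central surface, the rounded interface (points outside
`X₁` which hit, with `M = 0`), and the tops of the ascending sheets (points outside `X₁` which do
not hit, with `f = c`). [cite: GayKirby2016, §4, Lemma 14] -/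
theorem mem_H₂₃_iff {x : X} :
    x ∈ T.H₂₃ ↔ x ∈ B.surface ∨ (x ∉ T.X₁ ∧ B.Hit x ∧ T.M x = 0) ∨ (x ∉ T.X₁ ∧ ¬ B.Hit x ∧ B.f x = T.c) := by
  constructor
  · intro hx
    by_cases h1 : x ∈ T.X₁
    · left
      rw [← T.H₂₃_inter_X₁ hc2]
      exact ⟨hx, h1⟩
    · rcases T.interface_of_mem_X₂_X₃ hη hL hx.1 hx.2 h1 with h | h
      · exact Or.inr (Or.inl ⟨h1, h⟩)
      · exact Or.inr (Or.inr ⟨h1, h⟩)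
  · rintro (h | ⟨h1, hh, hM⟩ | ⟨h1, hh, hc⟩)
    · exact T.surface_subset_H₂₃ h
    · exact ⟨(T.mem_X₂_iff_of_hit hh h1).2 hM.le, (T.mem_X₃_iff_of_hit hh h1).2 hM.ge⟩
    · exact ⟨T.sheets_subset_X₂ ⟨T.a_le_of_not_mem_X₁_of_not_hit h1 hh, hc.le, hh⟩, T.mem_X₃_of_le hc.ge⟩

end

/-- **Near the central surface, `H₂₃` is the half-sheet `{r = 0, s ≥ 0}` over `F`**: on the
bi-collar box of radius `ε_w`, `X₂ = {r ≤ 0, s - κ r ≥ 0}` and `X₃ = {r ≥ 0, s + κ r ≥ 0}`.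
[cite: GayKirby2016, Def. 1 and Fig. 1] -/
theorem mem_H₂₃_iff_of_mem_box {x : X} (hx : x ∈ B.box T.D.εw) :
    x ∈ T.H₂₃ ↔ B.rFun x = 0 ∧ 0 ≤ B.sFun x := by
  rw [H₂₃, mem_inter_iff, T.mem_X₂_iff_of_mem_box hx, T.mem_X₃_iff_of_mem_box hx,
    T.uFun_frame₂, T.vFun_frame₂, T.uFun_frame₃, T.vFun_frame₃]
  have hκ := T.D.κ_pos
  constructor
  · rintro ⟨⟨hu2, hv2⟩, hu3, hv3⟩
    have hr : B.rFun x = 0 := by linarith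
    refine ⟨hr, ?_⟩
    rw [hr] at hu2
    linarith
  · rintro ⟨hr, hs⟩
    rw [hr]
    refine ⟨⟨by linarith, by linarith⟩, by linarith, by linarith⟩

/-- On the box, the points of `H₂₃` with `s = 0` are the points of `F`. [cite: GayKirby2016, Def. 1] -/
theorem mem_surface_iff_of_mem_H₂₃_of_mem_box {x : X} (hx : x ∈ B.box T.D.εw) (h : x ∈ T.H₂₃) :
    x ∈ B.surface ↔ B.sFun x = 0 := by
  rw [B.mem_surface_iff]
  exact ⟨fun h' => h'.1, fun hs => ⟨hs, ((T.mem_H₂₃_iff_of_mem_box hx).1 h).1⟩⟩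

/-- The points of `H₂₃` which hit and lie outside `X₁` have `M = 0`. [cite: GayKirby2016, §4, Lemma 14] -/
theorem M_eq_zero_of_mem_H₂₃ {x : X} (hx : x ∈ T.H₂₃) (hh : B.Hit x) : T.M x = 0 :=
  le_antisymm (T.M_nonpos_of_mem_X₂ hh hx.1) (T.M_nonneg_of_mem_X₃ hh hx.2)

/-- The points of `H₂₃` outside `X₁` which do not hit are tops of sheets: `f = c`. [cite: GayKirby2016, §4, Lemma 14] -/
theorem f_eq_c_of_mem_H₂₃ {η : ℝ} (hη : 2 * T.ε ≤ η)
    (hL : ∀ q : X, IsMCriticalPt (𝓡 4) B.f q → B.a < B.f q → B.f q ≤ T.c →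
      ∀ y : B.Y, RegularLevel.incl B.hf y ∈ stableSet (𝓡 4) B.U.ξ q → B.g y < B.b - η)
    {x : X} (hx : x ∈ T.H₂₃) (hx₁ : x ∉ T.X₁) (hh : ¬ B.Hit x) : B.f x = T.c := by
  rcases T.interface_of_mem_X₂_X₃ hη hL hx.1 hx.2 hx₁ with h | h
  · exact absurd h.1 hh
  · exact h.2

end TriData

end BiCollar

end Literature.Topology.FourManifolds

end
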